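import Summits.CriticalPhenomena.Ising3DConformalLimit.Theorems.PrecisionLaplacianDirectCorrelationStableTailPickInversionAux8
import Summits.CriticalPhenomena.Ising3DConformalLimit.Theorems.PrecisionLaplacianDirectCorrelationStableTailPickInversionAux3

/-!
# Diagonal line holomorphy, auxiliary file 1: the two-sided Poisson kernel
# `P_y(θ) = (1 - y²)/(1 - 2y cos θ + y²)`, `y ∈ [-1, 1]`, for complex angles `θ`

Helper file for the sub-stub `stub_slabModeExpDecay_auxDiagLineHol` (brick of `stub_slabModeExpDecay`)
of line `self-energy-pick-inversion`, crux `PrecisionLaplacian.DirectCorrelationStableTail`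
(stmt-CriticalPhenomena-4799). Pure theorem file.

Along a diagonal frame line the Green symbol function of the critical walk dictionary is a Poisson
integral `(1/π) ∫_{[-1,1]} P_y(θ) dν(y)` of a finite *positive* measure on the two-sided interval
`[-1, 1]` (files 2–5). Kernel facts:

* `norm_one_sub_two_mul_cos_add_sq_ge` : `sin²(Re θ) ≤ |1 - 2y cos θ + y²|` for real `y`, complex `θ`
  (`1 - 2y cos θ + y² = (1 - y e^{iθ})(1 - y e^{-iθ})` and `|1 - ρ e^{ia}|² - sin² a = (ρ - cos a)²`);
* `differentiableOn_poissonLine`, `norm_poissonLine_le`, `poissonLine_ofReal` : holomorphy, the bound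
  `ν(ℝ)/sin²(Re θ)` and the real trace of `θ ↦ ∫ P_y(θ) dν(y)` on `{sin (Re θ) ≠ 0}` for a finite
  measure `ν` carried by `[-1, 1]`;
* `two_pi_mul_eq_integral_poisson_of_Icc_neg_one` (registered sub-goal
  `stub_slabModeExpDecay_auxDiagLineHol2`): if `g` is continuous, even, `2π`-periodic and
  `∫_{-π}^{π} g(θ) cos(nθ) dθ = ∫ yⁿ dν(y)` (`n : ℕ`) for a finite positive measure `ν` on `[-1, 1]`, then
  `2π g(θ) = ∫ P_y(θ) dν(y)` whenever `cos θ ≠ ±1` (Abel summation as in file `…PickInversionAux2`).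

References: Akhiezer, *The classical moment problem*, Ch. 3; Katznelson, *An introduction to harmonic
analysis*, Ch. I §3.
-/

noncomputable section

namespace Summit.CriticalPhenomena.Ising3DConformalLimit.Cruxes.DirectCorrelationStableTail.SelfEnergyPickInversion

open MeasureTheory Filter Topology Set Real Complex Metric
open scoped BigOperators
open Literature.Analysis.Complex

/-! ### The denominator `1 - 2y cos θ + y²` for complex `θ` -/

/-- `|1 - ρ e^{ia}|² ≥ sin² a` for all real `ρ, a` (the difference is `(ρ - cos a)²`). [folklore] -/
theorem sin_sq_le_normSq_one_sub_mul_exp (ρ a : ℝ) :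
    Real.sin a ^ 2 ≤ Complex.normSq (1 - (ρ : ℂ) * Complex.exp (a * Complex.I)) := by
  rw [Complex.normSq_apply]
  simp only [Complex.sub_re, Complex.one_re, Complex.re_ofReal_mul, Complex.exp_ofReal_mul_I_re,
    Complex.sub_im, Complex.one_im, Complex.im_ofReal_mul, Complex.exp_ofReal_mul_I_im, zero_sub]
  nlinarith [Real.sin_sq_add_cos_sq a, sq_nonneg (ρ - Real.cos a)]

/-- `y e^{iθ} = (y e^{-Im θ}) e^{i Re θ}` for real `y` and complex `θ`. [folklore] -/
theorem ofReal_mul_exp_mul_I (y : ℝ) (θ : ℂ) :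
    (y : ℂ) * Complex.exp (θ * Complex.I) =
      ((y * Real.exp (-θ.im) : ℝ) : ℂ) * Complex.exp ((θ.re : ℝ) * Complex.I) := by
  conv_lhs => rw [← Complex.re_add_im θ]
  rw [add_mul, Complex.exp_add]
  have h : (θ.im : ℂ) * Complex.I * Complex.I = ((-θ.im : ℝ) : ℂ) := by
    rw [mul_assoc, Complex.I_mul_I]; push_cast; ring
  rw [h, ← Complex.ofReal_exp]
  push_cast
  ring

/-- **The factorisation** `1 - 2y cos θ + y² = (1 - y e^{iθ})(1 - y e^{-iθ})`. [folklore] -/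
theorem one_sub_two_mul_cos_add_sq_eq (y : ℂ) (θ : ℂ) :
    1 - 2 * y * Complex.cos θ + y ^ 2 =
      (1 - y * Complex.exp (θ * Complex.I)) * (1 - y * Complex.exp (-θ * Complex.I)) := by
  rw [Complex.cos]
  have h : Complex.exp (θ * Complex.I) * Complex.exp (-θ * Complex.I) = 1 := by
    rw [← Complex.exp_add]; simp
  linear_combination (-y ^ 2) * h

/-- **Lower bound for the denominator**: `sin²(Re θ) ≤ |1 - 2y cos θ + y²|` for real `y` and complex
`θ`. [folklore] -/
theorem norm_one_sub_two_mul_cos_add_sq_ge (y : ℝ) (θ : ℂ) :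
    Real.sin θ.re ^ 2 ≤ ‖1 - 2 * (y : ℂ) * Complex.cos θ + (y : ℂ) ^ 2‖ := by
  rw [one_sub_two_mul_cos_add_sq_eq, norm_mul]
  have key : ∀ ρ a : ℝ, |Real.sin a| ≤ ‖1 - (ρ : ℂ) * Complex.exp ((a : ℝ) * Complex.I)‖ := by
    intro ρ a
    refine abs_le_of_sq_le_sq ?_ (norm_nonneg _)
    rw [Complex.sq_norm]
    exact sin_sq_le_normSq_one_sub_mul_exp ρ a
  have h1 : |Real.sin θ.re| ≤ ‖1 - (y : ℂ) * Complex.exp (θ * Complex.I)‖ := by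
    rw [ofReal_mul_exp_mul_I]
    exact key _ _
  have h2 : |Real.sin θ.re| ≤ ‖1 - (y : ℂ) * Complex.exp (-θ * Complex.I)‖ := by
    rw [ofReal_mul_exp_mul_I y (-θ), Complex.neg_re]
    have h := key (y * Real.exp (-(-θ).im)) (-θ.re)
    rwa [Real.sin_neg, abs_neg] at h
  calc Real.sin θ.re ^ 2 = |Real.sin θ.re| * |Real.sin θ.re| := by rw [← sq, sq_abs]
    _ ≤ _ := mul_le_mul h1 h2 (abs_nonneg _) (norm_nonneg _)

/-- Off the vertical lines `Re θ ∈ πℤ` the denominator does not vanish. [folklore] -/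
theorem one_sub_two_mul_cos_add_sq_ne_zero (y : ℝ) {θ : ℂ} (hθ : Real.sin θ.re ≠ 0) :
    1 - 2 * (y : ℂ) * Complex.cos θ + (y : ℂ) ^ 2 ≠ 0 := by
  intro h
  have := norm_one_sub_two_mul_cos_add_sq_ge y θ
  rw [h, norm_zero] at this
  exact hθ (by nlinarith [sq_nonneg (Real.sin θ.re)])

/-- **Bound for the kernel**: `‖(1 - y²)/(1 - 2y cos θ + y²)‖ ≤ 1/sin²(Re θ)` for `y ∈ [-1, 1]`.
[folklore] -/
theorem norm_poissonLineKernel_le {y : ℝ} (hy : y ∈ Set.Icc (-1 : ℝ) 1) {θ : ℂ} (hθ : Real.sin θ.re ≠ 0) :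
    ‖((1 - y ^ 2 : ℝ) : ℂ) / (1 - 2 * (y : ℂ) * Complex.cos θ + (y : ℂ) ^ 2)‖ ≤ 1 / Real.sin θ.re ^ 2 := by
  rw [norm_div, Complex.norm_real, Real.norm_eq_abs]
  have h1 : |1 - y ^ 2| ≤ 1 := by
    rw [abs_le]; constructor <;> nlinarith [hy.1, hy.2]
  have hpos : 0 < Real.sin θ.re ^ 2 := by positivity
  calc |1 - y ^ 2| / ‖1 - 2 * (y : ℂ) * Complex.cos θ + (y : ℂ) ^ 2‖
      ≤ 1 / ‖1 - 2 * (y : ℂ) * Complex.cos θ + (y : ℂ) ^ 2‖ :=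
        div_le_div_of_nonneg_right h1 (norm_nonneg _)
    _ ≤ 1 / Real.sin θ.re ^ 2 :=
        div_le_div_of_nonneg_left zero_le_one hpos (norm_one_sub_two_mul_cos_add_sq_ge y θ)

/-- Measurability of the kernel in `y`. [folklore] -/
theorem measurable_poissonLineKernel (θ : ℂ) :
    Measurable fun y : ℝ => ((1 - y ^ 2 : ℝ) : ℂ) / (1 - 2 * (y : ℂ) * Complex.cos θ + (y : ℂ) ^ 2) :=
  (Complex.measurable_ofReal.comp (by fun_prop)).div (by fun_prop)

/-! ### The Poisson integral of a finite measure on `[-1, 1]` along a complex line -/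

/-- The set `{θ : sin (Re θ) ≠ 0}` is open. [folklore] -/
theorem isOpen_setOf_sin_re_ne_zero : IsOpen {θ : ℂ | Real.sin θ.re ≠ 0} :=
  isOpen_ne_fun (Real.continuous_sin.comp Complex.continuous_re) continuous_const

/-- Near a point with `sin (Re θ₀) ≠ 0`, `|sin (Re θ)| ≥ |sin (Re θ₀)|/2` on the ball of radius
`|sin (Re θ₀)|/2`. [folklore] -/
theorem half_abs_sin_le_of_mem_ball {θ₀ θ : ℂ} (hθ : θ ∈ ball θ₀ (|Real.sin θ₀.re| / 2)) :
    |Real.sin θ₀.re| / 2 ≤ |Real.sin θ.re| := by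
  rw [mem_ball, dist_eq_norm] at hθ
  have h1 : |Real.sin θ.re - Real.sin θ₀.re| ≤ |θ.re - θ₀.re| := Real.abs_sin_sub_sin_le _ _
  have h2 : |θ.re - θ₀.re| ≤ ‖θ - θ₀‖ := by
    rw [← Complex.sub_re]; exact Complex.abs_re_le_norm _
  have h3 := abs_sub_abs_le_abs_sub (Real.sin θ₀.re) (Real.sin θ.re)
  rw [abs_sub_comm] at h3
  linarith

/-- **Holomorphy of the Poisson line integral.** For a finite measure `ν` carried by `[-1, 1]`,
`θ ↦ ∫ (1 - y²)/(1 - 2y cos θ + y²) dν(y)` is holomorphic on `{θ : sin (Re θ) ≠ 0}`. [folklore] -/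
theorem differentiableOn_poissonLine (ν : Measure ℝ) [IsFiniteMeasure ν] (hν : ν (Set.Icc (-1 : ℝ) 1)ᶜ = 0) :
    DifferentiableOn ℂ (fun θ : ℂ => ∫ y, ((1 - y ^ 2 : ℝ) : ℂ) /
      (1 - 2 * (y : ℂ) * Complex.cos θ + (y : ℂ) ^ 2) ∂ν) {θ : ℂ | Real.sin θ.re ≠ 0} := by
  have hae : ∀ᵐ y ∂ν, y ∈ Set.Icc (-1 : ℝ) 1 := by
    rw [ae_iff]; simpa only [Set.mem_setOf_eq, ← Set.mem_compl_iff, Set.setOf_mem_eq] using hν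
  apply differentiableOn_integral_of_dominated
  · exact fun θ _ => (measurable_poissonLineKernel θ).aestronglyMeasurable
  · filter_upwards [hae] with y hy
    refine DifferentiableOn.div (differentiableOn_const _) (by fun_prop) fun θ hθ => ?_
    exact one_sub_two_mul_cos_add_sq_ne_zero y hθ
  · intro θ₀ hθ₀
    have hθ₀' : Real.sin θ₀.re ≠ 0 := hθ₀
    have hpos : 0 < |Real.sin θ₀.re| / 2 := by positivity
    refine ⟨|Real.sin θ₀.re| / 2, hpos, fun θ hθ => ?_, fun _ => 1 / (|Real.sin θ₀.re| / 2) ^ 2,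
      integrable_const _, ?_⟩
    · have := half_abs_sin_le_of_mem_ball hθ
      show Real.sin θ.re ≠ 0
      intro h0; rw [h0, abs_zero] at this; linarith
    · filter_upwards [hae] with y hy
      intro θ hθ
      have hle := half_abs_sin_le_of_mem_ball hθ
      have hθ' : Real.sin θ.re ≠ 0 := by intro h0; rw [h0, abs_zero] at hle; linarith
      refine (norm_poissonLineKernel_le hy hθ').trans ?_
      refine div_le_div_of_nonneg_left zero_le_one (by positivity) ?_
      rw [← sq_abs (Real.sin θ.re)]
      exact pow_le_pow_left₀ hpos.le hle 2

/-- **Bound of the Poisson line integral**: `‖∫ P_y(θ) dν(y)‖ ≤ ν(ℝ)/sin²(Re θ)`. [folklore] -/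
theorem norm_poissonLine_le (ν : Measure ℝ) [IsFiniteMeasure ν] (hν : ν (Set.Icc (-1 : ℝ) 1)ᶜ = 0)
    {θ : ℂ} (hθ : Real.sin θ.re ≠ 0) :
    ‖∫ y, ((1 - y ^ 2 : ℝ) : ℂ) / (1 - 2 * (y : ℂ) * Complex.cos θ + (y : ℂ) ^ 2) ∂ν‖ ≤
      ν.real Set.univ * (1 / Real.sin θ.re ^ 2) := by
  have hae : ∀ᵐ y ∂ν, y ∈ Set.Icc (-1 : ℝ) 1 := by
    rw [ae_iff]; simpa only [Set.mem_setOf_eq, ← Set.mem_compl_iff, Set.setOf_mem_eq] using hν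
  calc ‖∫ y, ((1 - y ^ 2 : ℝ) : ℂ) / (1 - 2 * (y : ℂ) * Complex.cos θ + (y : ℂ) ^ 2) ∂ν‖
      ≤ ∫ y, ‖((1 - y ^ 2 : ℝ) : ℂ) / (1 - 2 * (y : ℂ) * Complex.cos θ + (y : ℂ) ^ 2)‖ ∂ν :=
        norm_integral_le_integral_norm _
    _ ≤ ∫ y, (1 / Real.sin θ.re ^ 2) ∂ν := by
        refine integral_mono_ae (Integrable.mono' (integrable_const (1 / Real.sin θ.re ^ 2))
          (measurable_poissonLineKernel θ).norm.aestronglyMeasurable ?_) (integrable_const _) ?_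
        · filter_upwards [hae] with y hy
          rw [norm_norm]; exact norm_poissonLineKernel_le hy hθ
        · filter_upwards [hae] with y hy
          exact norm_poissonLineKernel_le hy hθ
    _ = ν.real Set.univ * (1 / Real.sin θ.re ^ 2) := by
        rw [integral_const, smul_eq_mul]

/-- **The real trace of the Poisson line integral**: at a real angle `θ`,
`∫ P_y(θ) dν(y)` (complex kernel) is the real integral `∫ (1 - y²)/(1 - 2y cos θ + y²) dν(y)`. [folklore] -/
theorem poissonLine_ofReal (ν : Measure ℝ) (θ : ℝ) :
    (∫ y, ((1 - y ^ 2 : ℝ) : ℂ) / (1 - 2 * (y : ℂ) * Complex.cos (θ : ℂ) + (y : ℂ) ^ 2) ∂ν) =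
      ((∫ y, (1 - y ^ 2) / (1 - 2 * y * Real.cos θ + y ^ 2) ∂ν : ℝ) : ℂ) := by
  rw [← Complex.ofReal_cos]
  exact poissonTransform_ofReal ν (Real.cos θ)

/-! ### The two-sided Poisson representation from cosine moments on `[-1, 1]` -/

/-- A uniform bound for the two-sided Poisson kernel at a fixed angle off both peaks: for `|ρ| < 1`
and `cos θ ≠ ±1`, `P_ρ(θ) ≤ 4 + 1/(1 - cos θ) + 1/(1 + cos θ)` (for `ρ < 0`,
`P_ρ(θ) = P_{|ρ|}(θ + π)`). [folklore] -/
theorem poisson_le_const_of_abs_lt {ρ θ : ℝ} (hρ : |ρ| < 1) (hθ : Real.cos θ ≠ 1) (hθ' : Real.cos θ ≠ -1) :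
    (1 - ρ ^ 2) / (1 - 2 * ρ * Real.cos θ + ρ ^ 2) ≤ 4 + 1 / (1 - Real.cos θ) + 1 / (1 + Real.cos θ) := by
  have hc1 : 0 < 1 - Real.cos θ := lt_of_le_of_ne (by linarith [Real.cos_le_one θ]) (by grind)
  have hc2 : 0 < 1 + Real.cos θ := lt_of_le_of_ne (by linarith [Real.neg_one_le_cos θ]) (by grind)
  rcases le_or_gt 0 ρ with h0 | h0
  · have h1 : ρ < 1 := by rwa [abs_of_nonneg h0] at hρ
    have := poisson_le_const h0 h1 hθ
    have : 0 ≤ 1 / (1 + Real.cos θ) := by positivity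
    linarith
  · -- `ρ < 0`: `P_ρ(θ) = P_{-ρ}(θ + π)`
    have h1 : -ρ < 1 := by rwa [abs_of_neg h0] at hρ
    have hθπ : Real.cos (θ + π) ≠ 1 := by rw [Real.cos_add_pi]; intro h; exact hθ' (by linarith)
    have h2 := poisson_le_const (neg_nonneg.2 h0.le) h1 hθπ
    rw [Real.cos_add_pi] at h2
    have h3 : (1 - (-ρ) ^ 2) / (1 - 2 * -ρ * -Real.cos θ + (-ρ) ^ 2) =
        (1 - ρ ^ 2) / (1 - 2 * ρ * Real.cos θ + ρ ^ 2) := by ring_nf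
    rw [h3, sub_neg_eq_add] at h2
    have : 0 ≤ 1 / (1 - Real.cos θ) := by positivity
    linarith

/-- **Two-sided Poisson representation from cosine moments.** Let `g : ℝ → ℝ` be continuous, even and
`2π`-periodic, and let `ν` be a finite positive measure on `[-1, 1]` with
`∫_{-π}^{π} g(θ) cos(nθ) dθ = ∫ yⁿ dν(y)` for all `n : ℕ`. Then for every `θ` with `cos θ ≠ 1` and
`cos θ ≠ -1`, `2π g(θ) = ∫ (1 - y²)/(1 - 2y cos θ + y²) dν(y)`. (Abel summation, as in
`two_pi_mul_eq_integral_poisson`; the bound `poisson_le_const_of_abs_lt` replaces `poisson_le_const`.)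
[folklore] -/
theorem two_pi_mul_eq_integral_poisson_of_Icc_neg_one {g : ℝ → ℝ} (hg : Continuous g)
    (hper : Function.Periodic g (2 * π)) (heven : ∀ θ, g (-θ) = g θ)
    {μ : Measure ℝ} [IsFiniteMeasure μ] (hμ : μ (Set.Icc (-1 : ℝ) 1)ᶜ = 0)
    (hmom : ∀ n : ℕ, ∫ θ in (-π)..π, g θ * Real.cos (n * θ) = ∫ t, t ^ n ∂μ)
    {θ : ℝ} (hθ : Real.cos θ ≠ 1) (hθ' : Real.cos θ ≠ -1) :
    2 * π * g θ = ∫ t, (1 - t ^ 2) / (1 - 2 * t * Real.cos θ + t ^ 2) ∂μ := by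
  -- adapted from `two_pi_mul_eq_integral_poisson` (file `…PickInversionAux2`)
  have hπ := Real.pi_pos
  have hae : ∀ᵐ t ∂μ, t ∈ Set.Icc (-1 : ℝ) 1 := by
    rw [ae_iff]; simpa only [Set.mem_setOf_eq, ← Set.mem_compl_iff, Set.setOf_mem_eq] using hμ
  set Cθ : ℝ := 4 + 1 / (1 - Real.cos θ) + 1 / (1 + Real.cos θ) with hCθ
  -- a bound for `g` on `[-π, π]`
  obtain ⟨M, hM⟩ : ∃ M : ℝ, ∀ φ ∈ Set.Icc (-π) π, |g φ| ≤ M := by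
    obtain ⟨M, hM⟩ := (isCompact_Icc (a := -π) (b := π)).exists_bound_of_continuousOn hg.continuousOn
    exact ⟨M, fun φ hφ => by rw [← Real.norm_eq_abs]; exact hM φ hφ⟩
  have hM0 : 0 ≤ M := le_trans (abs_nonneg _) (hM 0 ⟨by linarith, by linarith⟩)
  -- `|r t| < 1` and `|t ^ k| ≤ 1` on the support
  have hrt : ∀ {r : ℝ}, 0 < r → r < 1 → ∀ {t : ℝ}, t ∈ Set.Icc (-1 : ℝ) 1 → |r * t| < 1 := by
    intro r hr0 hr1 t ht
    rw [abs_mul, abs_of_pos hr0]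
    have : |t| ≤ 1 := abs_le.2 ⟨ht.1, ht.2⟩
    calc r * |t| ≤ r * 1 := by gcongr
      _ < 1 := by linarith
  have htk : ∀ {t : ℝ}, t ∈ Set.Icc (-1 : ℝ) 1 → ∀ k : ℕ, |t ^ k| ≤ 1 := by
    intro t ht k
    rw [abs_pow]
    exact pow_le_one₀ (abs_nonneg t) (abs_le.2 ⟨ht.1, ht.2⟩)
  -- the two Abel means
  set A : ℝ → ℝ := fun r => ∫ t, (1 - (r * t) ^ 2) / (1 - 2 * (r * t) * Real.cos θ + (r * t) ^ 2) ∂μ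
    with hA
  set B : ℝ → ℝ := fun r => ∫ φ in (-π)..π,
    (1 - r ^ 2) / (1 - 2 * r * Real.cos (θ - φ) + r ^ 2) * g φ with hB
  -- Claim 1: `A r = B r` for `0 < r < 1`
  have claim1 : ∀ r : ℝ, 0 < r → r < 1 → A r = B r := by
    intro r hr0 hr1
    have hr : |r| < 1 := by rw [abs_of_pos hr0]; exact hr1
    have hgeo : Summable fun n : ℕ => 2 * r ^ (n + 1) :=
      ((summable_geometric_of_lt_one hr0.le hr1).mul_left (2 * r)).congr fun n => by ring
    -- the series for `A r - m₀`
    have hL : HasSum (fun n : ℕ => ∫ t, 2 * (r * t) ^ (n + 1) * Real.cos ((n + 1 : ℕ) * θ) ∂μ)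
        (∫ t, ((1 - (r * t) ^ 2) / (1 - 2 * (r * t) * Real.cos θ + (r * t) ^ 2) - 1) ∂μ) := by
      refine hasSum_integral_of_dominated_convergence (fun n _ => 2 * r ^ (n + 1))
        (fun n => (Continuous.aestronglyMeasurable (by fun_prop))) ?_ ?_ ?_ ?_
      · intro n
        filter_upwards [hae] with t ht
        rw [Real.norm_eq_abs, abs_mul, abs_mul, abs_of_nonneg (by norm_num : (0:ℝ) ≤ 2), mul_pow,
          abs_mul, abs_of_nonneg (pow_nonneg hr0.le _)]
        have h1 : |t ^ (n + 1)| ≤ 1 := htk ht _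
        have h2 := Real.abs_cos_le_one ((n + 1 : ℕ) * θ)
        have h3 : 0 ≤ 2 * r ^ (n + 1) := by positivity
        calc 2 * (r ^ (n + 1) * |t ^ (n + 1)|) * |Real.cos ((n + 1 : ℕ) * θ)|
            ≤ 2 * (r ^ (n + 1) * 1) * 1 := by gcongr
          _ = 2 * r ^ (n + 1) := by ring
      · exact Eventually.of_forall fun t => hgeo
      · exact integrable_const _
      · filter_upwards [hae] with t ht
        exact hasSum_poisson_sub_one (hrt hr0 hr1 ht) θ
    have hLterm : ∀ n : ℕ, ∫ t, 2 * (r * t) ^ (n + 1) * Real.cos ((n + 1 : ℕ) * θ) ∂μ =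
        2 * r ^ (n + 1) * Real.cos ((n + 1 : ℕ) * θ) * ∫ t, t ^ (n + 1) ∂μ := by
      intro n
      rw [← MeasureTheory.integral_const_mul]
      congr 1; ext t; rw [mul_pow]; ring
    -- the series for `B r - m₀`
    have hR : HasSum (fun n : ℕ => ∫ φ in (-π)..π,
        2 * r ^ (n + 1) * Real.cos ((n + 1 : ℕ) * (θ - φ)) * g φ)
        (∫ φ in (-π)..π, ((1 - r ^ 2) / (1 - 2 * r * Real.cos (θ - φ) + r ^ 2) - 1) * g φ) := by
      refine intervalIntegral.hasSum_integral_of_dominated_convergence (fun n _ => 2 * r ^ (n + 1) * M)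
        (fun n => (Continuous.aestronglyMeasurable (by fun_prop))) ?_ ?_ ?_ ?_
      · intro n
        filter_upwards with φ hφ
        rw [Set.uIoc_of_le (by linarith)] at hφ
        rw [Real.norm_eq_abs, abs_mul, abs_mul, abs_mul, abs_of_nonneg (by norm_num : (0:ℝ) ≤ 2),
          abs_of_nonneg (pow_nonneg hr0.le _)]
        have h1 := Real.abs_cos_le_one ((n + 1 : ℕ) * (θ - φ))
        have h2 := hM φ ⟨hφ.1.le, hφ.2⟩
        have h3 : 0 ≤ 2 * r ^ (n + 1) := by positivity
        calc 2 * r ^ (n + 1) * |Real.cos ((n + 1 : ℕ) * (θ - φ))| * |g φ|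
            ≤ 2 * r ^ (n + 1) * 1 * M := by gcongr
          _ = 2 * r ^ (n + 1) * M := by ring
      · exact Eventually.of_forall fun φ _ => hgeo.mul_right M
      · exact intervalIntegrable_const
      · filter_upwards with φ _
        exact (hasSum_poisson_sub_one hr (θ - φ)).mul_right _
    have hRterm : ∀ n : ℕ, ∫ φ in (-π)..π, 2 * r ^ (n + 1) * Real.cos ((n + 1 : ℕ) * (θ - φ)) * g φ
        = 2 * r ^ (n + 1) * Real.cos ((n + 1 : ℕ) * θ) * ∫ t, t ^ (n + 1) ∂μ := by
      intro n
      have hexp : ∀ φ : ℝ, 2 * r ^ (n + 1) * Real.cos ((n + 1 : ℕ) * (θ - φ)) * g φ =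
          (2 * r ^ (n + 1) * Real.cos ((n + 1 : ℕ) * θ)) * (g φ * Real.cos ((n + 1 : ℕ) * φ)) +
          (2 * r ^ (n + 1) * Real.sin ((n + 1 : ℕ) * θ)) * (g φ * Real.sin ((n + 1 : ℕ) * φ)) := by
        intro φ; rw [mul_sub, Real.cos_sub]; ring
      simp_rw [hexp]
      rw [intervalIntegral.integral_add, intervalIntegral.integral_const_mul,
        intervalIntegral.integral_const_mul, hmom (n + 1), integral_even_mul_sin heven]
      · ring
      · exact ((hg.mul (by fun_prop)).intervalIntegrable _ _).const_mul _
      · exact ((hg.mul (by fun_prop)).intervalIntegrable _ _).const_mul _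
    have hsame : (fun n : ℕ => ∫ t, 2 * (r * t) ^ (n + 1) * Real.cos ((n + 1 : ℕ) * θ) ∂μ) =
        fun n : ℕ => ∫ φ in (-π)..π, 2 * r ^ (n + 1) * Real.cos ((n + 1 : ℕ) * (θ - φ)) * g φ := by
      funext n; rw [hLterm, hRterm]
    rw [hsame] at hL
    have hdiff := hL.unique hR
    have hm0 : ∫ φ in (-π)..π, g φ = ∫ t, (1 : ℝ) ∂μ := by simpa using hmom 0
    have hintA : Integrable (fun t => (1 - (r * t) ^ 2) / (1 - 2 * (r * t) * Real.cos θ + (r * t) ^ 2)) μ := by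
      refine Integrable.mono' (integrable_const Cθ) (Measurable.aestronglyMeasurable (by fun_prop)) ?_
      filter_upwards [hae] with t ht
      have h := hrt hr0 hr1 ht
      rw [Real.norm_eq_abs, abs_of_nonneg (poisson_nonneg h θ)]
      exact poisson_le_const_of_abs_lt h hθ hθ'
    have hPcont : Continuous fun φ => (1 - r ^ 2) / (1 - 2 * r * Real.cos (θ - φ) + r ^ 2) :=
      Continuous.div continuous_const (by fun_prop) fun φ => (poisson_den_pos hr (θ - φ)).ne'
    have hint2 : Integrable (fun t => (1 - (r * t) ^ 2) / (1 - 2 * (r * t) * Real.cos θ + (r * t) ^ 2) - 1) μ :=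
      hintA.sub (integrable_const 1)
    have hA' : A r = (∫ t, ((1 - (r * t) ^ 2) / (1 - 2 * (r * t) * Real.cos θ + (r * t) ^ 2) - 1) ∂μ)
        + ∫ t, (1 : ℝ) ∂μ := by
      rw [← integral_add hint2 (integrable_const 1)]
      simp only [hA]
      exact integral_congr_ae (ae_of_all _ fun t => by ring)
    have hB' : B r = (∫ φ in (-π)..π, ((1 - r ^ 2) / (1 - 2 * r * Real.cos (θ - φ) + r ^ 2) - 1) * g φ)
        + ∫ φ in (-π)..π, g φ := by
      rw [hB]; simp only
      rw [← intervalIntegral.integral_add]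
      · congr 1; ext φ; ring
      · exact ((hPcont.sub continuous_const).mul hg).intervalIntegrable _ _
      · exact hg.intervalIntegrable _ _
    rw [hA', hB', hdiff, hm0]
  -- Claim 2: `B r → 2π g θ`
  have claim2 : Tendsto B (𝓝[<] 1) (𝓝 (2 * π * g θ)) := tendsto_integral_poisson_mul hg hper θ
  -- Claim 3: `A r → ∫ P_t(θ) dμ` (dominated convergence)
  have claim3 : Tendsto A (𝓝[<] 1)
      (𝓝 (∫ t, (1 - t ^ 2) / (1 - 2 * t * Real.cos θ + t ^ 2) ∂μ)) := by
    refine tendsto_integral_filter_of_dominated_convergence (fun _ => Cθ) ?_ ?_ (integrable_const _) ?_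
    · exact Eventually.of_forall fun r => Measurable.aestronglyMeasurable (by fun_prop)
    · have hev : ∀ᶠ r in 𝓝[<] (1 : ℝ), r ∈ Set.Ioo (0 : ℝ) 1 := Ioo_mem_nhdsLT (by norm_num)
      filter_upwards [hev] with r hr
      filter_upwards [hae] with t ht
      have h := hrt hr.1 hr.2 ht
      rw [Real.norm_eq_abs, abs_of_nonneg (poisson_nonneg h θ)]
      exact poisson_le_const_of_abs_lt h hθ hθ'
    · filter_upwards [hae] with t ht
      -- continuity of `r ↦ P_{rt}(θ)` at `r = 1`
      have hden1 : 1 - 2 * (1 * t) * Real.cos θ + (1 * t) ^ 2 ≠ 0 := by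
        rw [one_mul]
        have habs : |t| ≤ 1 := abs_le.2 ⟨ht.1, ht.2⟩
        rcases habs.lt_or_eq with h1 | h1
        · exact (poisson_den_pos h1 θ).ne'
        · intro h
          rcases (abs_eq zero_le_one).1 h1 with h2 | h2
          · rw [h2] at h; apply hθ; nlinarith
          · rw [h2] at h; apply hθ'; nlinarith
      have hcont : ContinuousAt (fun r : ℝ =>
          (1 - (r * t) ^ 2) / (1 - 2 * (r * t) * Real.cos θ + (r * t) ^ 2)) 1 :=
        ContinuousAt.div (by fun_prop) (by fun_prop) hden1
      have h := hcont.tendsto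
      simp only [one_mul] at h
      exact h.mono_left nhdsWithin_le_nhds
  have hAB : A =ᶠ[𝓝[<] 1] B := by
    have hev : ∀ᶠ r in 𝓝[<] (1 : ℝ), r ∈ Set.Ioo (0 : ℝ) 1 := Ioo_mem_nhdsLT (by norm_num)
    filter_upwards [hev] with r hr
    exact claim1 r hr.1 hr.2
  exact tendsto_nhds_unique claim2 (claim3.congr' hAB)

/-- **Registered auxiliary stub `stub_slabModeExpDecay_auxDiagLineHol2`** (sub-goal of the brick
`stub_slabModeExpDecay_auxDiagLineHol` of `stub_slabModeExpDecay`): the two-sided Poisson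
representation `2π g(θ) = ∫_{[-1,1]} (1 - y²)/(1 - 2y cos θ + y²) dν(y)` (`cos θ ≠ ±1`) of an even
continuous `2π`-periodic `g` whose cosine moments are the moments of a finite positive measure on
`[-1, 1]` (`two_pi_mul_eq_integral_poisson_of_Icc_neg_one`). [folklore] -/
theorem stub_slabModeExpDecay_auxDiagLineHol2 : ∀ (g : ℝ → ℝ) (ν : MeasureTheory.Measure ℝ), Continuous g → Function.Periodic g (2 * Real.pi) → (∀ θ : ℝ, g (-θ) = g θ) → MeasureTheory.IsFiniteMeasure ν → ν (Set.Icc (-1 : ℝ) 1)ᶜ = 0 → (∀ n : ℕ, ∫ θ in (-Real.pi)..Real.pi, g θ * Real.cos (n * θ) = ∫ y, y ^ n ∂ν) → ∀ θ : ℝ, Real.cos θ ≠ 1 → Real.cos θ ≠ -1 → 2 * Real.pi * g θ = ∫ y, (1 - y ^ 2) / (1 - 2 * y * Real.cos θ + y ^ 2) ∂ν :=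
  fun _ _ hg hper heven hfin hν hmom _ hθ hθ' =>
    haveI := hfin
    two_pi_mul_eq_integral_poisson_of_Icc_neg_one hg hper heven hν hmom hθ hθ'

end Summit.CriticalPhenomena.Ising3DConformalLimit.Cruxes.DirectCorrelationStableTail.SelfEnergyPickInversion

end
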